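import Summits.ValiantsHypothesis.ValiantsHypothesis.Theses.DetQP
import Summits.ValiantsHypothesis.ValiantsHypothesis.Theses.UlrichPadded
import Summits.ValiantsHypothesis.ValiantsHypothesis.Theorems.DetqpThesis.Negative.NotQPBoundedOfExp
import Summits.ValiantsHypothesis.ValiantsHypothesis.Theorems.DetqpThesis.Negative.IffPerNotVQP
import Summits.ValiantsHypothesis.ValiantsHypothesis.Theorems.DetqpThesis.Negative.Variants
import Literature.Computability.AlgebraicComplexity.DeterminantalComplexityProofs
import Summits.ValiantsHypothesis.ValiantsHypothesis.Theorems.DetQPDetqpThesisStubLinearisation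
import Summits.ValiantsHypothesis.ValiantsHypothesis.Theorems.DetQPDetqpThesisStubPerLeRankPer

/-!
# `DetqpThesis` (stmt-ValiantsHypothesis-0315), line `chow-rank-ladder` — calibration of the bet
# `stub_rankHardness` (C⁺): floor `⇔ X`, ceiling = the exponential regime

Crux `X := DetQP.DetqpThesis = ¬ IsQPBounded (n ↦ dc (per_n / ℂ))` (= `UlrichPadded.Target`).
The line (crux-plan skeleton `Cruxes/DetqpThesis/Lines/chow_rank_ladder.lean`) closes `X` from two
registered stubs only: LINEARISATION (S1)
`dc (P n r) ≤ (1 + r n²) · dc (per_n)` for the rank-`r` permanent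
`P n r := per_n (U Vᵀ) = aeval (x_{ij} ↦ Σ_a U_{ia} V_{ja}) per_n` (`2nr` variables), and the bet
RANK-HARDNESS (S2, `C⁺`) `∃ p q A, ∀ r ≥ 1, ∀ n ≥ r^A, n^{p r} ≤ dc (P n r)^q`.  This file takes
the registered stub statements VERBATIM as hypotheses (nothing is assumed about their truth) and
kernel-checks where the bet sits relative to the crux:

* §1 CEILING (the exponential regime).  S1 + S2 give `2^r ≤ dc (per_N)` for ALL `N ≥ r^A` and all
  large `r` (`exp_regime_of_linearisation_of_rankHardness`): an everywhere-eventual lower bound of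
  type `exp (N^{1/A})` for the determinantal complexity of the permanent (record in print:
  Mignon–Ressayre `n²/2`).  The skeleton's own transfer proves this along `N = r^A`; monotonicity of
  `n ↦ dc (per_n)` (`Negative.dcPer_monotone`) spreads it to every `N`.  So the bet is strictly
  stronger than `X` in growth (exp vs. super-quasi-polynomial) and in form (for all large `N` vs.
  infinitely often) — the "exponential regime" of the crux's calibration rule
  (`Cruxes/DetqpThesis/NOTES.md`, rule 3).
* §2 FLOOR.  The weakest statement about the rank family that still closes `X` through S1 is the
  ESCAPE property `∀ c, ∃ n r, (1 + r n²) · 2^{(log₂ n + c)^c} < dc (P n r)`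
  (`detqpThesis_of_linearisation_of_escape`); conversely `X` and the top pin S5
  (`dc (per_r) ≤ dc (P n r)`, `r ≤ n`) give it back (`escape_of_perLeRankPer_of_detqpThesis`).  So
  modulo the two provable bookkeeping stubs S1, S5 the weakest load-bearing reshape of the bet is a
  RESTATEMENT of `X`; every reshape lies between `X` (floor) and the registered `C⁺` (ceiling, §1).
* §3 TRANSFER AND UNCONDITIONAL FORMS.  With S1 (p141664) and S5 (p142196) landed in wave 1:
  the registered bet ALONE implies `X` (`detqpThesis_of_rankHardness`, a conditional closing that
  credits nothing) and the exponential regime (`exp_regime_of_rankHardness`), and the escape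
  property is `⇔ X` outright (`escape_iff_detqpThesis_landed`).  Part B
  (`…RankHardnessCalibrationB.lean`): uniform Bombieri-tightness ⇒ the bet (via the landed degree
  floor `2n ≤ dc (P n r)`, p144789), and the bet ⇒ the rungs `stub_polyRung` ⇒ `stub_kvRung`.

Nothing here bears on the fixed-rank milestones S3/S4 (`stub_polyRung`, `stub_kvRung`), which are
not hypotheses of the skeleton's `DetqpThesis_of`.

Sources: the crux-plan skeleton (planner-cruxplan-…-chow-rank-ladder-0, 2026-08-17; `diag_arith`,
`two_pow_le_dcPer_comp` re-derived); Barvinok, Math. Oper. Res. 21 (1996) (rank-`r` permanents in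
`n^{O(r)}`); Mignon–Ressayre, IMRN 2004; Grenet 2011; Bürgisser 2000, §2.5, Def. 2.26. -/

-- single-conjunct layout: Sub = Summit, duplicated namespace component intended
set_option linter.dupNamespace false

noncomputable section

namespace Summit.ValiantsHypothesis.ValiantsHypothesis.Theorems.DetQPDetqpThesis.RankHardnessCalibration

open MvPolynomial
open scoped BigOperators
open Literature.Computability.AlgebraicComplexity
open Summit.ValiantsHypothesis.Theorems.DetqpThesis.Negative
open Summit.ValiantsHypothesis.ValiantsHypothesis.Theorems.DetQPDetqpThesis

/-! ## §1 Ceiling: S1 + S2 put `dc (per)` in the exponential regime -/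

/-- Arithmetic of the diagonal (from the crux-plan skeleton): for `A ≥ 2`, `p ≥ 1` and
`r ≥ 2^{(2A+2) q}`, `((1 + r · (r^A)²) · 2^r)^q ≤ (r^A)^{p r}`. [folklore] -/
theorem diag_arith {p q A r : ℕ} (hp : 1 ≤ p) (hA : 2 ≤ A) (hr : 2 ^ ((2 * A + 2) * q) ≤ r) :
    ((1 + r * (r ^ A) ^ 2) * 2 ^ r) ^ q ≤ (r ^ A) ^ (p * r) := by
  have hr1 : 1 ≤ r := le_trans Nat.one_le_two_pow hr
  have hlt : r < 2 ^ r := Nat.lt_two_pow_self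
  have h1 : 1 + r * (r ^ A) ^ 2 ≤ 2 ^ ((2 * A + 1) * r) := by
    have e1 : r * (r ^ A) ^ 2 = r ^ (2 * A + 1) := by ring
    have e2 : 2 ^ ((2 * A + 1) * r) = (2 ^ r) ^ (2 * A + 1) := by rw [← pow_mul]; ring_nf
    rw [e1, e2]
    have : r ^ (2 * A + 1) < (2 ^ r) ^ (2 * A + 1) := Nat.pow_lt_pow_left hlt (by omega)
    omega
  have h2 : (1 + r * (r ^ A) ^ 2) * 2 ^ r ≤ 2 ^ ((2 * A + 2) * r) := by
    calc (1 + r * (r ^ A) ^ 2) * 2 ^ r ≤ 2 ^ ((2 * A + 1) * r) * 2 ^ r :=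
          Nat.mul_le_mul_right _ h1
      _ = 2 ^ ((2 * A + 2) * r) := by rw [← pow_add]; ring_nf
  calc ((1 + r * (r ^ A) ^ 2) * 2 ^ r) ^ q ≤ (2 ^ ((2 * A + 2) * r)) ^ q := Nat.pow_le_pow_left h2 _
    _ = (2 ^ ((2 * A + 2) * q)) ^ r := by rw [← pow_mul, ← pow_mul]; ring_nf
    _ ≤ r ^ r := Nat.pow_le_pow_left hr _
    _ = r ^ (1 * (1 * r)) := by ring_nf
    _ ≤ r ^ (A * (p * r)) := Nat.pow_le_pow_right hr1
          (Nat.mul_le_mul (by omega) (Nat.mul_le_mul_right _ hp))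
    _ = (r ^ A) ^ (p * r) := by rw [pow_mul]

/-- **The skeleton's transfer, diagonal form** (re-derived): LINEARISATION (S1) and RANK-HARDNESS
(S2), both taken verbatim as hypotheses, give `2^r ≤ dc (per_{r^A})` for all `r ≥ 2^{(2A+2) q}`:
at `n = r^A`, `dc (per_n)^q · (1 + r n²)^q ≥ dc (P n r)^q ≥ n^{p r} ≥ ((1 + r n²) · 2^r)^q`.
[folklore] -/
theorem two_pow_le_dcPer_pow_of_linearisation_of_rankHardness
    (hL : ∀ n r : ℕ, determinantalComplexity (aeval (fun x : Fin n × Fin n => ∑ a : Fin r,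
          (X (Sum.inl (x.1, a)) * X (Sum.inr (x.2, a)) :
            MvPolynomial ((Fin n × Fin r) ⊕ (Fin n × Fin r)) ℂ)) (perPoly (Fin n) ℂ))
        ≤ (1 + r * n ^ 2) * determinantalComplexity (perPoly (Fin n) ℂ))
    (hR : ∃ p q A : ℕ, 0 < p ∧ 0 < q ∧ 2 ≤ A ∧ ∀ r : ℕ, 1 ≤ r → ∀ n : ℕ, r ^ A ≤ n →
      n ^ (p * r) ≤ determinantalComplexity (aeval (fun x : Fin n × Fin n => ∑ a : Fin r,
            (X (Sum.inl (x.1, a)) * X (Sum.inr (x.2, a)) :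
              MvPolynomial ((Fin n × Fin r) ⊕ (Fin n × Fin r)) ℂ)) (perPoly (Fin n) ℂ)) ^ q) :
    ∃ A : ℕ, 2 ≤ A ∧ ∃ r₀ : ℕ, ∀ r : ℕ, r₀ ≤ r →
      2 ^ r ≤ determinantalComplexity (perPoly (Fin (r ^ A)) ℂ) := by
  obtain ⟨p, q, A, hp, hq, hA, h⟩ := hR
  refine ⟨A, hA, 2 ^ ((2 * A + 2) * q), fun r hr => ?_⟩
  have hr1 : 1 ≤ r := le_trans Nat.one_le_two_pow hr
  set n := r ^ A with hn
  set d := determinantalComplexity (perPoly (Fin n) ℂ) with hd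
  have key : n ^ (p * r) ≤ ((1 + r * n ^ 2) * d) ^ q :=
    (h r hr1 n le_rfl).trans (Nat.pow_le_pow_left (hL n r) _)
  have harith : ((1 + r * n ^ 2) * 2 ^ r) ^ q ≤ n ^ (p * r) := diag_arith hp hA hr
  have h1 : ((1 + r * n ^ 2) * 2 ^ r) ^ q ≤ ((1 + r * n ^ 2) * d) ^ q := harith.trans key
  have h2 : (1 + r * n ^ 2) * 2 ^ r ≤ (1 + r * n ^ 2) * d :=
    (Nat.pow_le_pow_iff_left (by omega)).1 h1
  exact Nat.le_of_mul_le_mul_left h2 (by positivity)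

/-- **§1 CEILING — the bet is the exponential regime.**  LINEARISATION (S1) + RANK-HARDNESS (S2),
verbatim as hypotheses, imply: for some `A ≥ 2` and all large `r`, `2^r ≤ dc (per_N)` for EVERY
`N ≥ r^A` — i.e. `dc (per_N) ≥ 2^{⌊N^{1/A}⌋}` for all large `N`, an everywhere-eventual
`exp (N^{1/A})`-type lower bound for the determinantal complexity of the permanent (the crux asks
only for "not quasi-polynomial", infinitely often; the record in print is `n²/2`).  Proof: the
diagonal bound at `N = r^A` and monotonicity of `n ↦ dc (per_n)` (`Negative.dcPer_monotone`,
`per_n` is a projection of `per_{n+1}`). [folklore] -/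
theorem exp_regime_of_linearisation_of_rankHardness
    (hL : ∀ n r : ℕ, determinantalComplexity (aeval (fun x : Fin n × Fin n => ∑ a : Fin r,
          (X (Sum.inl (x.1, a)) * X (Sum.inr (x.2, a)) :
            MvPolynomial ((Fin n × Fin r) ⊕ (Fin n × Fin r)) ℂ)) (perPoly (Fin n) ℂ))
        ≤ (1 + r * n ^ 2) * determinantalComplexity (perPoly (Fin n) ℂ))
    (hR : ∃ p q A : ℕ, 0 < p ∧ 0 < q ∧ 2 ≤ A ∧ ∀ r : ℕ, 1 ≤ r → ∀ n : ℕ, r ^ A ≤ n →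
      n ^ (p * r) ≤ determinantalComplexity (aeval (fun x : Fin n × Fin n => ∑ a : Fin r,
            (X (Sum.inl (x.1, a)) * X (Sum.inr (x.2, a)) :
              MvPolynomial ((Fin n × Fin r) ⊕ (Fin n × Fin r)) ℂ)) (perPoly (Fin n) ℂ)) ^ q) :
    ∃ A : ℕ, 2 ≤ A ∧ ∃ r₀ : ℕ, ∀ r : ℕ, r₀ ≤ r → ∀ N : ℕ, r ^ A ≤ N →
      2 ^ r ≤ determinantalComplexity (perPoly (Fin N) ℂ) := by
  obtain ⟨A, hA, r₀, h⟩ := two_pow_le_dcPer_pow_of_linearisation_of_rankHardness hL hR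
  exact ⟨A, hA, r₀, fun r hr N hN => (h r hr).trans (dcPer_monotone ℂ hN)⟩

/-! ## §2 Floor: the weakest load-bearing reshape of the bet is a restatement of `X` -/

/-- **§2a — any ESCAPE of the rank family closes the crux (through S1 alone).**  If for every
template constant `c` some rank-`r` permanent beats the qp bound by more than the linearisation
loss, `(1 + r n²) · 2^{(log₂ n + c)^c} < dc (P n r)`, then `X` holds: `dc (P n r) ≤ (1 + r n²) ·
dc (per_n)` (S1) would otherwise bound it by the same quantity.  This is the weakest form a
load-bearing bet of this line can take. [folklore] -/
theorem detqpThesis_of_linearisation_of_escape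
    (hL : ∀ n r : ℕ, determinantalComplexity (aeval (fun x : Fin n × Fin n => ∑ a : Fin r,
          (X (Sum.inl (x.1, a)) * X (Sum.inr (x.2, a)) :
            MvPolynomial ((Fin n × Fin r) ⊕ (Fin n × Fin r)) ℂ)) (perPoly (Fin n) ℂ))
        ≤ (1 + r * n ^ 2) * determinantalComplexity (perPoly (Fin n) ℂ))
    (hW : ∀ c : ℕ, ∃ n r : ℕ, (1 + r * n ^ 2) * 2 ^ ((Nat.log 2 n + c) ^ c) <
      determinantalComplexity (aeval (fun x : Fin n × Fin n => ∑ a : Fin r,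
          (X (Sum.inl (x.1, a)) * X (Sum.inr (x.2, a)) :
            MvPolynomial ((Fin n × Fin r) ⊕ (Fin n × Fin r)) ℂ)) (perPoly (Fin n) ℂ))) :
    Summit.ValiantsHypothesis.ValiantsHypothesis.Theses.DetQP.DetqpThesis := by
  unfold Summit.ValiantsHypothesis.ValiantsHypothesis.Theses.DetQP.DetqpThesis
  rintro ⟨c, hc⟩
  obtain ⟨n, r, h⟩ := hW c
  have h1 := hL n r
  have h2 : (1 + r * n ^ 2) * determinantalComplexity (perPoly (Fin n) ℂ) ≤
      (1 + r * n ^ 2) * 2 ^ ((Nat.log 2 n + c) ^ c) := Nat.mul_le_mul_left _ (hc n)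
  omega

/-- Template arithmetic for §2b: `(1 + n³) · 2^{(ℓ + c)^c} ≤ 2^{(ℓ + c + 3)^{c + 3}}` with
`ℓ = log₂ n`. [folklore] -/
theorem linLoss_mul_qpBound_le (n c : ℕ) :
    (1 + n * n ^ 2) * 2 ^ ((Nat.log 2 n + c) ^ c) ≤ 2 ^ ((Nat.log 2 n + (c + 3)) ^ (c + 3)) := by
  set ℓ := Nat.log 2 n with hℓ
  -- `1 + n³ ≤ 2^{3ℓ + 3}`
  have hn : n < 2 ^ (ℓ + 1) := Nat.lt_pow_succ_log_self one_lt_two n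
  have h1 : 1 + n * n ^ 2 ≤ 2 ^ (3 * (ℓ + 1)) := by
    have e : (n + 1) ^ 3 = n * n ^ 2 + 3 * n ^ 2 + 3 * n + 1 := by ring
    calc 1 + n * n ^ 2 ≤ (n + 1) ^ 3 := by rw [e]; omega
      _ ≤ (2 ^ (ℓ + 1)) ^ 3 := Nat.pow_le_pow_left hn _
      _ = 2 ^ (3 * (ℓ + 1)) := by rw [← pow_mul]; ring_nf
  -- `3ℓ + 3 + (ℓ + c)^c ≤ (ℓ + c + 3)^{c+3}`
  set m := ℓ + c with hm
  have hmc : 1 ≤ m ^ c := by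
    rcases Nat.eq_zero_or_pos c with h0 | hpos
    · rw [h0, pow_zero]
    · exact Nat.one_le_pow _ _ (by omega)
  have hcube : 9 * m + 27 ≤ (m + 3) ^ 3 := by
    have e : (m + 3) ^ 3 = m ^ 3 + 9 * m ^ 2 + 27 * m + 27 := by ring
    rw [e]; nlinarith
  have h2 : 3 * (ℓ + 1) + m ^ c ≤ (m + 3) ^ (c + 3) := by
    calc 3 * (ℓ + 1) + m ^ c ≤ m ^ c * (9 * m + 27) := by nlinarith
      _ ≤ m ^ c * (m + 3) ^ 3 := Nat.mul_le_mul_left _ hcube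
      _ ≤ (m + 3) ^ c * (m + 3) ^ 3 :=
          Nat.mul_le_mul_right _ (Nat.pow_le_pow_left (Nat.le_add_right m 3) _)
      _ = (m + 3) ^ (c + 3) := by rw [← pow_add]
  have e3 : ℓ + (c + 3) = m + 3 := by omega
  calc (1 + n * n ^ 2) * 2 ^ (m ^ c) ≤ 2 ^ (3 * (ℓ + 1)) * 2 ^ (m ^ c) :=
        Nat.mul_le_mul_right _ h1
    _ = 2 ^ (3 * (ℓ + 1) + m ^ c) := by rw [← pow_add]
    _ ≤ 2 ^ ((m + 3) ^ (c + 3)) := Nat.pow_le_pow_right (by norm_num) h2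
    _ = 2 ^ ((ℓ + (c + 3)) ^ (c + 3)) := by rw [e3]

/-- **§2b — conversely, `X` and the top pin give the escape.**  From `X` (every template constant
is violated by `dc (per_n)` at some `n`, applied at the constant `c + 3` to absorb the factor
`1 + n³`, `linLoss_mul_qpBound_le`) and the TOP PIN S5 at `r = n` (`dc (per_n) ≤ dc (P n n)`),
the rank family escapes every qp bound by more than the linearisation loss, with `r ≤ n`.  With
§2a: modulo the bookkeeping stubs S1 and S5, "the rank family escapes" `⇔ X` — the floor of every
load-bearing reshape of the bet is the crux itself. [folklore] -/
theorem escape_of_perLeRankPer_of_detqpThesis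
    (h5 : ∀ r n : ℕ, r ≤ n → determinantalComplexity (perPoly (Fin r) ℂ) ≤
      determinantalComplexity (aeval (fun x : Fin n × Fin n => ∑ a : Fin r,
          (X (Sum.inl (x.1, a)) * X (Sum.inr (x.2, a)) :
            MvPolynomial ((Fin n × Fin r) ⊕ (Fin n × Fin r)) ℂ)) (perPoly (Fin n) ℂ)))
    (hX : Summit.ValiantsHypothesis.ValiantsHypothesis.Theses.DetQP.DetqpThesis) :
    ∀ c : ℕ, ∃ n r : ℕ, r ≤ n ∧ (1 + r * n ^ 2) * 2 ^ ((Nat.log 2 n + c) ^ c) <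
      determinantalComplexity (aeval (fun x : Fin n × Fin n => ∑ a : Fin r,
          (X (Sum.inl (x.1, a)) * X (Sum.inr (x.2, a)) :
            MvPolynomial ((Fin n × Fin r) ⊕ (Fin n × Fin r)) ℂ)) (perPoly (Fin n) ℂ)) := by
  intro c
  have hX' := (not_isQPBounded_iff_frequently.1 hX) (c + 3) 0
  obtain ⟨n, -, hn⟩ := hX'
  refine ⟨n, n, le_rfl, ?_⟩
  calc (1 + n * n ^ 2) * 2 ^ ((Nat.log 2 n + c) ^ c)
      ≤ 2 ^ ((Nat.log 2 n + (c + 3)) ^ (c + 3)) := linLoss_mul_qpBound_le n c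
    _ < determinantalComplexity (perPoly (Fin n) ℂ) := hn
    _ ≤ determinantalComplexity (aeval (fun x : Fin n × Fin n => ∑ a : Fin n,
          (X (Sum.inl (x.1, a)) * X (Sum.inr (x.2, a)) :
            MvPolynomial ((Fin n × Fin n) ⊕ (Fin n × Fin n)) ℂ)) (perPoly (Fin n) ℂ)) :=
        h5 n n le_rfl

/-- **§2, packaged: floor `⇔ X`.**  Modulo S1 (linearisation) and S5 (top pin), both provable
bookkeeping, the escape property of the rank family is EQUIVALENT to the crux. [folklore] -/
theorem escape_iff_detqpThesis
    (hL : ∀ n r : ℕ, determinantalComplexity (aeval (fun x : Fin n × Fin n => ∑ a : Fin r,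
          (X (Sum.inl (x.1, a)) * X (Sum.inr (x.2, a)) :
            MvPolynomial ((Fin n × Fin r) ⊕ (Fin n × Fin r)) ℂ)) (perPoly (Fin n) ℂ))
        ≤ (1 + r * n ^ 2) * determinantalComplexity (perPoly (Fin n) ℂ))
    (h5 : ∀ r n : ℕ, r ≤ n → determinantalComplexity (perPoly (Fin r) ℂ) ≤
      determinantalComplexity (aeval (fun x : Fin n × Fin n => ∑ a : Fin r,
          (X (Sum.inl (x.1, a)) * X (Sum.inr (x.2, a)) :
            MvPolynomial ((Fin n × Fin r) ⊕ (Fin n × Fin r)) ℂ)) (perPoly (Fin n) ℂ))) :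
    (∀ c : ℕ, ∃ n r : ℕ, r ≤ n ∧ (1 + r * n ^ 2) * 2 ^ ((Nat.log 2 n + c) ^ c) <
      determinantalComplexity (aeval (fun x : Fin n × Fin n => ∑ a : Fin r,
          (X (Sum.inl (x.1, a)) * X (Sum.inr (x.2, a)) :
            MvPolynomial ((Fin n × Fin r) ⊕ (Fin n × Fin r)) ℂ)) (perPoly (Fin n) ℂ))) ↔
      Summit.ValiantsHypothesis.ValiantsHypothesis.Theses.DetQP.DetqpThesis :=
  ⟨fun hW => detqpThesis_of_linearisation_of_escape hL fun c =>
      let ⟨n, r, _, h⟩ := hW c; ⟨n, r, h⟩,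
    escape_of_perLeRankPer_of_detqpThesis h5⟩

/-! ## §3 The transfer with S1 discharged, and the unconditional forms (S1, S5 landed) -/

/-- (E') of the disproof file, re-derived from the landed Negative lemmas (as in the skeleton): an
eventual bound `2^r - 1 ≤ t (p r)` along a p-bounded `p` makes `t` not quasi-polynomially
bounded. [folklore] -/
theorem not_isQPBounded_of_eventually_ge_comp {t p : ℕ → ℕ} (hp : IsPBounded p)
    (h : ∃ n₀, ∀ n ≥ n₀, 2 ^ n - 1 ≤ t (p n)) : ¬ IsQPBounded t := by
  rintro ⟨c, hc⟩
  obtain ⟨c', hc'⟩ := qpBound_comp_le hp c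
  exact not_isQPBounded_of_eventually_ge h ⟨c', fun n => (hc (p n)).trans (hc' n)⟩

/-- **The skeleton's transfer with S1 discharged**: the registered bet alone now implies the crux
(`DetQP.DetqpThesis` by name, under the hypothesis `hR` = `stub_rankHardness` verbatim — a
CONDITIONAL closing, recorded for calibration; it credits nothing). [folklore] -/
theorem detqpThesis_of_rankHardness
    (hR : ∃ p q A : ℕ, 0 < p ∧ 0 < q ∧ 2 ≤ A ∧ ∀ r : ℕ, 1 ≤ r → ∀ n : ℕ, r ^ A ≤ n →
      n ^ (p * r) ≤ determinantalComplexity (aeval (fun x : Fin n × Fin n => ∑ a : Fin r,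
            (X (Sum.inl (x.1, a)) * X (Sum.inr (x.2, a)) :
              MvPolynomial ((Fin n × Fin r) ⊕ (Fin n × Fin r)) ℂ)) (perPoly (Fin n) ℂ)) ^ q) :
    Summit.ValiantsHypothesis.ValiantsHypothesis.Theses.DetQP.DetqpThesis := by
  obtain ⟨A, -, r₀, h⟩ :=
    two_pow_le_dcPer_pow_of_linearisation_of_rankHardness
      ChowRankLinearisation.stub_linearisation hR
  unfold Summit.ValiantsHypothesis.ValiantsHypothesis.Theses.DetQP.DetqpThesis
  exact not_isQPBounded_of_eventually_ge_comp (p := fun r => r ^ A)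
    ⟨A, fun n => Nat.le_add_right _ _⟩ ⟨r₀, fun r hr => (Nat.sub_le _ _).trans (h r hr)⟩

/-- **§1 unconditional in S1.**  With LINEARISATION landed
(`ChowRankLinearisation.stub_linearisation`, p141664), the registered bet ALONE puts `dc (per)`
in the exponential regime: `∃ A ≥ 2, ∃ r₀, ∀ r ≥ r₀, ∀ N ≥ r^A, 2^r ≤ dc (per_N)`. [folklore] -/
theorem exp_regime_of_rankHardness :
    (∃ p q A : ℕ, 0 < p ∧ 0 < q ∧ 2 ≤ A ∧ ∀ r : ℕ, 1 ≤ r → ∀ n : ℕ, r ^ A ≤ n →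
      n ^ (p * r) ≤ determinantalComplexity (aeval (fun x : Fin n × Fin n => ∑ a : Fin r,
            (X (Sum.inl (x.1, a)) * X (Sum.inr (x.2, a)) :
              MvPolynomial ((Fin n × Fin r) ⊕ (Fin n × Fin r)) ℂ)) (perPoly (Fin n) ℂ)) ^ q) →
    ∃ A : ℕ, 2 ≤ A ∧ ∃ r₀ : ℕ, ∀ r : ℕ, r₀ ≤ r → ∀ N : ℕ, r ^ A ≤ N →
      2 ^ r ≤ determinantalComplexity (perPoly (Fin N) ℂ) :=
  fun hR => exp_regime_of_linearisation_of_rankHardness ChowRankLinearisation.stub_linearisation hR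

/-- **§2 unconditional in S1, S5.**  With LINEARISATION (p141664) and the TOP PIN
(`ChowRankPerLeRankPer.stub_perLeRankPer`, p142196) landed, the escape property of the rank
family is equivalent to the crux outright: the weakest load-bearing reshape of the bet is `X`
itself. [folklore] -/
theorem escape_iff_detqpThesis_landed :
    (∀ c : ℕ, ∃ n r : ℕ, r ≤ n ∧ (1 + r * n ^ 2) * 2 ^ ((Nat.log 2 n + c) ^ c) <
      determinantalComplexity (aeval (fun x : Fin n × Fin n => ∑ a : Fin r,
          (X (Sum.inl (x.1, a)) * X (Sum.inr (x.2, a)) :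
            MvPolynomial ((Fin n × Fin r) ⊕ (Fin n × Fin r)) ℂ)) (perPoly (Fin n) ℂ))) ↔
      Summit.ValiantsHypothesis.ValiantsHypothesis.Theses.DetQP.DetqpThesis :=
  escape_iff_detqpThesis ChowRankLinearisation.stub_linearisation
    ChowRankPerLeRankPer.stub_perLeRankPer

end Summit.ValiantsHypothesis.ValiantsHypothesis.Theorems.DetQPDetqpThesis.RankHardnessCalibration

end
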